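/-
Copyright: statement-level skeleton of a published paper (lit-balaban cell, Phase-2 proof seat p39 gen 19). No proof claims
beyond what the kernel checks below.
-/
import Literature.MathematicalPhysics.QuantumFieldTheory.Balaban1983to89.B3Graph221cZeroLattice
import Literature.MathematicalPhysics.QuantumFieldTheory.Balaban1983to89.B3GammaPrimeVanishing

/-!
# B3 — T. Bałaban, *(Higgs)₂,₃ quantum fields in a finite volume. III. Renormalization*, CMP **88** (1983) 411–445
[Balaban1983Higgs3], p. 444 [PDF 34]: the replacement sentence for the graph **(2.21c)** AT THE TREE'S TYPED KERNEL — the bridge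
from the typed factor `Σ_{x,x″}η^{2d}Γ^{(2.21)c}_μ(x,x′,x″)` of `B3GammaPrimeVanishing` (`locFactorZ (gamma221cZ …)` =
`coeff336Z (gamma221c …)`, the external vertex `x″` summed last) to the kernel-slot factor `fac221c` of `B3Graph221cZeroLattice`
(the internal vertex summed last), and the resulting bound: *"Now we replace the propagators G^η_{j₀}(0), G^η_{j₀} by C^ξ … We get a
convergent expression plus Σ_{y,y″}ξ^{2d}Γ″_μ … For the graph (2.21c) it equals 0 also because by translation invariance it can be
written as a derivative of a constant."*

statement-level skeleton of published theorems with citation tags; proofs where landed; nothing here is a claim about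
the Yang–Mills mass gap

PDF held: `paper:balaban1983-higgs-2-3-quantum-fields-finite-volume` (journal page = PDF page + 410); p. 444 [PDF 34] read on the
×2 render `run/shared/lean/pub/pub-balaban/b2b-balaban-ref1/pages/1983-cmp88-higgs23-III/1983-cmp88-higgs23-III-p034-x2.png`.  Row
**B3.Eq3.33-3.38** of `HOME/lit-balaban-r15/ROWS-B3.md` (fold owner r15; head `proved`; located member).  CONTEXT.  The tree's typed
(2.21c) factor (`B3GammaPrimeVanishing`, p32: `coeff336Z η (gamma221c η G₁ G₂ G₃) μ x′` of PART I and `locFactorZ η (gamma221cZ η G₁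
G₂ G₃) μ x′` of PART II, both `= Σ'_{x″}η^{d+1}Σ'_zη^{d+1}Σ_ν(∂^η_μG₁∂^{η*}_ν)(x′,z)(G₂∂^{η*}_ν)(z,x″)G₃(z,x″)`) is proved to VANISH
there for translation-invariant lines (`coeff336Z_221c_eq_zero`, `locFactorZ_gamma221cZ_cxi_eq_zero`); `B3Graph221cZeroLattice` (this
seat, same generation) proves the REPLACEMENT sentence for the kernel-slot factor `fac221c` on ξℤ³ with the lattice propagators
`G^ξ_k(0)` in the slots.  THIS FILE identifies the two (at `d + 1 = 3`, the two iterated sums agree by absolute convergence — Fubini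
on ℤ³ × ℤ³ for a double family dominated by products of propagator profiles) and states the replacement sentence for the typed
factor itself.
WHAT IS PROVED:
* §1 `coeff336Z_gamma221c_eq_locFactorZ` — PART I's and PART II's typed (2.21c) factors are the same number (any `d`, `η ≠ 0`).
* §2 **`locFactorZ_gamma221cZ_eq_fac221c`** — at `d + 1 = 3`: `Σ_{x,x″}ξ^{2d}Γ^{(2.21)c}_μ[G₁,G₂,G₃](x,x′,x″) = F[G₁,G₂,G₃](x′)`
  whenever the double family `(z,x″) ↦ ξ⁶Σ_ν(∂_μG₁∂^*_ν)(x′,z)(G₂∂^*_ν)(z,x″)G₃(z,x″)` is summable and the loops converge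
  (`Summable.tsum_comm`); `summable_uncurry_of_laws` — the double family IS summable for kernels with the propagator laws (shear
  `(z,x″) ↦ (z, z − x″)` of ℤ³ × ℤ³ and a product majorant).
* §3 **`exists_locFactorZ_gamma221cZ_bound`** — for `L = ℓ+1 ≥ 2` and a window `[a₋,a₊] × [0,m²₊]`, `a₋ > 0`, there is `Cst` such
  that for every `k ≥ 1`, all three parameter pairs in the window, all `μ`, `x′`, with `G_i = G^ξ_k(0)` (`GxiL`) in the slots: the
  typed factor equals `F[G₁,G₂,G₃](x′)`, **`|Σ_{x,x″}ξ^{2d}Γ^{(2.21)c}_μ[G₁,G₂,G₃]| ≤ Cst`** uniformly, and the same with `C^ξ` in every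
  slot is `0` (`B3GammaPrimeVanishing.locFactorZ_gamma221cZ_cxi_eq_zero`) — *"a convergent expression plus [a term that] equals 0"*.
HONEST SCOPE: as `B3Graph221cZeroLattice` (zero field, `d = 3`, infinite lattice, scalar structure part, model instance for the
vector line); theorems only, no definitions, no named facts; Mathlib + the cited tree files only; standard axioms.  Unit
`lit-balaban-p39` (Phase-2 proof seat p39, gen 19), HOME `run/shared/lean/pub/lit-balaban/`, 2026-08-23.
-/

open scoped BigOperators
open Finset Filter Topology

namespace Literature.MathematicalPhysics.QuantumFieldTheory.Balaban1983to89.B3Graph221cZeroLatticeBridge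

open B3Sect3VectorSelfEnergy B3CxiUniformBound B3ZdLatticeProfileSums B3ZdKernelConvolutions B3Eq316ResolventZeroLattice
  B3Eq316DifferenceKernelBounds
open B3Ineq313Lattice (KernelZ)
open B3Eq326ZeroLattice (dAdjKernelZ d2KernelZ dAdjKernelZ_eq_dK2 d2KernelZ_eq_d2K)
open B3GammaPrimeVanishing (SKernel3Z coeff336Z locFactorZ atFirst ker221c gamma221c gamma221cZ convKZ coeff336Z_atFirst
  locFactorZ_gamma221cZ locFactorZ_gamma221cZ_cxi_eq_zero)
open B3Eq337ZeroLattice (convK summable_prof_sub)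
open B3Graph221cZeroLattice (loop221c fac221c exists_fac221c_bound summable_prof_sub')
open B3CxiPropagator (summable_Cxi)

noncomputable section

/-! ## §1 PART I's and PART II's typed (2.21c) factors agree -/

section PartOne

variable {d : ℕ}

/-- kernel: `coeff336Z η (gamma221c η G₁ G₂ G₃) μ x′ = locFactorZ η (gamma221cZ η G₁ G₂ G₃) μ x′` — the (2.21c) factor of PART I
(`atFirst`/`ker221c`) and of PART II (`vtxZ`) of `B3GammaPrimeVanishing` are the same iterated sum
`Σ'_{x″}η^{d+1}Σ'_zη^{d+1}Σ_ν(∂^η_μG₁∂^{η*}_ν)(x′,z)(G₂∂^{η*}_ν)(z,x″)G₃(z,x″)` (`η ≠ 0`, any `d`). [cite: Balaban1983Higgs3, (2.21) p.430; (3.36) p.444] -/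
theorem coeff336Z_gamma221c_eq_locFactorZ {η : ℝ} (hη : η ≠ 0) (G₁ G₂ G₃ : KernelZ d) (μ : Fin (d + 1))
    (x' : Fin (d + 1) → ℤ) :
    coeff336Z η (gamma221c η G₁ G₂ G₃) μ x' = locFactorZ η (gamma221cZ η G₁ G₂ G₃) μ x' := by
  rw [locFactorZ_gamma221cZ hη, gamma221c, coeff336Z_atFirst η hη, ← tsum_mul_left]
  rfl

end PartOne

/-! ## §2 The two summation orders agree (Fubini on ℤ³ × ℤ³) -/

section Swap

variable {ξ : ℝ}

/-- **THE TYPED (2.21c) FACTOR IS THE KERNEL-SLOT FACTOR** at `d + 1 = 3`: `Σ_{x,x″}ξ^{2d}Γ^{(2.21)c}_μ[G₁,G₂,G₃](x,x′,x″) =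
F[G₁,G₂,G₃](x′)` — the external vertex `x″` summed last (`B3GammaPrimeVanishing`) or the internal vertex `z` summed last
(`B3Graph221cZeroLattice.fac221c`) — whenever the double family `(z,x″) ↦ ξ³·ξ³Σ_ν(∂_μG₁∂^*_ν)(x′,z)(G₂∂^*_ν)(z,x″)G₃(z,x″)` is
summable and each loop series converges (`Summable.tsum_comm`). [cite: Balaban1983Higgs3, (3.36) p.444] -/
theorem locFactorZ_gamma221cZ_eq_fac221c (hξ : ξ ≠ 0) (G₁ G₂ G₃ : KernelZ 2) (μ : Fin 3) (x' : ZSite 3)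
    (hF : Summable (Function.uncurry fun (z x'' : ZSite 3) =>
      ξ ^ 3 * (ξ ^ 3 * ∑ ν : Fin 3, d2K ξ μ ν G₁ x' z * (dK2 ξ ν G₂ z x'' * G₃ z x''))))
    (hloop : ∀ (ν : Fin 3) (z : ZSite 3), Summable fun x'' : ZSite 3 => ξ ^ 3 * (dK2 ξ ν G₂ z x'' * G₃ z x'')) :
    locFactorZ (d := 2) ξ (gamma221cZ ξ G₁ G₂ G₃) μ x' = fac221c ξ μ G₁ G₂ G₃ x' := by
  rw [locFactorZ_gamma221cZ hξ]
  -- the summand in gen 9's kernel vocabulary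
  have hker : ∀ (z x'' : ZSite 3), ∑ ν : Fin (2 + 1), d2KernelZ ξ⁻¹ μ ν G₁ x' z * (dAdjKernelZ ξ⁻¹ ν G₂ z x'' * G₃ z x'') =
      ∑ ν : Fin 3, d2K ξ μ ν G₁ x' z * (dK2 ξ ν G₂ z x'' * G₃ z x'') := by
    intro z x''
    refine sum_congr rfl fun ν _ => ?_
    rw [d2KernelZ_eq_d2K, dAdjKernelZ_eq_dK2]
  simp_rw [hker]
  -- pull the inner volume factor inside: `ξ³·Σ'_z ξ³S = Σ'_z ξ³(ξ³S)`
  simp_rw [← tsum_mul_left]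
  -- Fubini: `Σ'_{x″}Σ'_z f z x″ = Σ'_zΣ'_{x″} f z x″`
  rw [hF.tsum_comm]
  -- the inner `x″`-sum is `ξ³Σ_ν(∂_μG₁∂^*_ν)(x′,z)·B_ν(z)`
  unfold fac221c loop221c
  refine tsum_congr fun z => ?_
  have hs : ∀ ν ∈ (univ : Finset (Fin 3)), Summable fun x'' : ZSite 3 =>
      d2K ξ μ ν G₁ x' z * (ξ ^ 3 * (dK2 ξ ν G₂ z x'' * G₃ z x'')) := fun ν _ => (hloop ν z).mul_left _
  have hpt : ∀ x'' : ZSite 3, ξ ^ 3 * (ξ ^ 3 * ∑ ν : Fin 3, d2K ξ μ ν G₁ x' z * (dK2 ξ ν G₂ z x'' * G₃ z x'')) =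
      ξ ^ 3 * ∑ ν : Fin 3, d2K ξ μ ν G₁ x' z * (ξ ^ 3 * (dK2 ξ ν G₂ z x'' * G₃ z x'')) := by
    intro x''; rw [mul_sum, mul_sum, mul_sum]; exact sum_congr rfl fun ν _ => by ring
  rw [tsum_congr hpt, tsum_mul_left, Summable.tsum_finsetSum hs]
  congr 1
  refine sum_congr rfl fun ν _ => ?_
  rw [tsum_mul_left]

/-- **the double family of the (2.21c) factor is summable** for kernels with the propagator laws (`|∂_μG₁∂^*_ν| ≤ C·P₃`,
`|G₂∂^*| ≤ C·P₂`, `|G₃| ≤ C·P₁`, `0 < ξ ≤ 1`): for each spacing it is dominated by `const·ξ³P₂(x′−z)·ξ³P₂(z−x″)`, a product family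
after the shear `(z,x″) ↦ (z, z − x″)` of ℤ³ × ℤ³. [cite: Balaban1983Higgs3, (3.36) p.444] -/
theorem summable_uncurry_of_laws (hξ : 0 < ξ) (hξ1 : ξ ≤ 1) {δ C : ℝ} (hδ : 0 < δ) (hδ1 : δ ≤ 1) (hC : 0 ≤ C)
    {G₁ G₂ G₃ : ZSite 3 → ZSite 3 → ℝ}
    (hG1 : ∀ (μ' μ : Fin 3) (x y : ZSite 3), |d2K ξ μ' μ G₁ x y| ≤ C * prof ξ δ 3 (x - y))
    (hG2 : ∀ (μ : Fin 3) (y z : ZSite 3), |dK2 ξ μ G₂ y z| ≤ C * prof ξ δ 2 (y - z))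
    (hG3 : ∀ y z : ZSite 3, |G₃ y z| ≤ C * prof ξ δ 1 (y - z)) (μ : Fin 3) (x' : ZSite 3) :
    Summable (Function.uncurry fun (z x'' : ZSite 3) =>
      ξ ^ 3 * (ξ ^ 3 * ∑ ν : Fin 3, d2K ξ μ ν G₁ x' z * (dK2 ξ ν G₂ z x'' * G₃ z x''))) := by
  -- the product majorant `A(z)·B(w)`, `w = z − x″`
  set A : ZSite 3 → ℝ := fun z => ξ ^ 3 * prof ξ δ 2 (z - x') with hA
  set B : ZSite 3 → ℝ := fun w => ξ ^ 3 * prof ξ δ 2 w with hB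
  have hAs : Summable A := (summable_prof_sub hξ hξ1 hδ hδ1 (le_refl 2) x').1
  have hBs : Summable B := by
    have h := (summable_prof_sub hξ hξ1 hδ hδ1 (le_refl 2) (0 : ZSite 3)).1
    simpa [hB] using h
  have hA0 : 0 ≤ A := fun z => by simp only [hA, Pi.zero_apply]; have := prof_nonneg hξ.le δ 2 (z - x'); positivity
  have hB0 : 0 ≤ B := fun w => by simp only [hB, Pi.zero_apply]; have := prof_nonneg hξ.le δ 2 w; positivity
  have hprod : Summable fun p : ZSite 3 × ZSite 3 => A p.1 * B p.2 := hAs.mul_of_nonneg hBs hA0 hB0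
  -- the shear `(z,x″) ↦ (z, z − x″)`
  set e : ZSite 3 × ZSite 3 ≃ ZSite 3 × ZSite 3 := Equiv.prodShear (Equiv.refl _) (fun z => Equiv.subLeft z) with he
  have hshear : Summable fun p : ZSite 3 × ZSite 3 => A p.1 * B (p.1 - p.2) := by
    have h := (e.summable_iff (f := fun p : ZSite 3 × ZSite 3 => A p.1 * B p.2)).2 hprod
    refine h.congr fun p => ?_
    simp [he, Equiv.prodShear, Function.comp]
  -- domination
  set M : ℝ := 3 * (C * C * C) * (ξ⁻¹ * ξ⁻¹) with hM
  refine Summable.of_norm_bounded (g := fun p : ZSite 3 × ZSite 3 => M * (A p.1 * B (p.1 - p.2))) (hshear.mul_left M)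
    fun p => ?_
  obtain ⟨z, x''⟩ := p
  simp only [Function.uncurry_apply_pair, Real.norm_eq_abs]
  have hν : ∀ ν : Fin 3, |d2K ξ μ ν G₁ x' z * (dK2 ξ ν G₂ z x'' * G₃ z x'')| ≤
      (C * C * C) * (ξ⁻¹ * ξ⁻¹) * (prof ξ δ 2 (z - x') * prof ξ δ 2 (z - x'')) := by
    intro ν
    rw [abs_mul, abs_mul]
    have h1 : |d2K ξ μ ν G₁ x' z| ≤ C * (ξ⁻¹ * prof ξ δ 2 (z - x')) := by
      refine (hG1 μ ν x' z).trans (mul_le_mul_of_nonneg_left ?_ hC)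
      rw [prof_sub_comm ξ δ 2 z x']
      exact prof_succ_le hξ δ 2 (x' - z)
    have h2 := hG2 ν z x''
    have h3 : |G₃ z x''| ≤ C * ξ⁻¹ := by
      refine (hG3 z x'').trans (mul_le_mul_of_nonneg_left ?_ hC)
      have h := profile_le_inv_pow hξ hδ.le 1 (z - x'')
      simp only [pow_one] at h
      unfold prof; simpa only [pow_one] using h
    have hp1 := prof_nonneg hξ.le δ 2 (z - x')
    have hp2 := prof_nonneg hξ.le δ 2 (z - x'')
    calc |d2K ξ μ ν G₁ x' z| * (|dK2 ξ ν G₂ z x''| * |G₃ z x''|)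
        ≤ (C * (ξ⁻¹ * prof ξ δ 2 (z - x'))) * ((C * prof ξ δ 2 (z - x'')) * (C * ξ⁻¹)) :=
          mul_le_mul h1 (mul_le_mul h2 h3 (abs_nonneg _) (by positivity)) (by positivity) (by positivity)
      _ = (C * C * C) * (ξ⁻¹ * ξ⁻¹) * (prof ξ δ 2 (z - x') * prof ξ δ 2 (z - x'')) := by ring
  have hsum : |∑ ν : Fin 3, d2K ξ μ ν G₁ x' z * (dK2 ξ ν G₂ z x'' * G₃ z x'')| ≤
      3 * ((C * C * C) * (ξ⁻¹ * ξ⁻¹) * (prof ξ δ 2 (z - x') * prof ξ δ 2 (z - x''))) := by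
    refine (abs_sum_le_sum_abs _ _).trans ?_
    calc ∑ ν : Fin 3, |d2K ξ μ ν G₁ x' z * (dK2 ξ ν G₂ z x'' * G₃ z x'')|
        ≤ ∑ _ν : Fin 3, (C * C * C) * (ξ⁻¹ * ξ⁻¹) * (prof ξ δ 2 (z - x') * prof ξ δ 2 (z - x'')) :=
          sum_le_sum fun ν _ => hν ν
      _ = 3 * ((C * C * C) * (ξ⁻¹ * ξ⁻¹) * (prof ξ δ 2 (z - x') * prof ξ δ 2 (z - x''))) := by
          simp [sum_const, card_univ, Fintype.card_fin]
  rw [abs_mul, abs_of_pos (pow_pos hξ 3), abs_mul, abs_of_pos (pow_pos hξ 3)]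
  calc ξ ^ 3 * (ξ ^ 3 * |∑ ν : Fin 3, d2K ξ μ ν G₁ x' z * (dK2 ξ ν G₂ z x'' * G₃ z x'')|)
      ≤ ξ ^ 3 * (ξ ^ 3 * (3 * ((C * C * C) * (ξ⁻¹ * ξ⁻¹) * (prof ξ δ 2 (z - x') * prof ξ δ 2 (z - x''))))) := by
        gcongr
    _ = M * (A z * B (z - x'')) := by simp only [hM, hA, hB]; ring

end Swap

/-! ## §3 The replacement sentence for the typed (2.21c) factor at the zero-field instance on ξℤ³ -/

section Main

variable {ℓ : ℕ}

/-- **p. 444 FOR THE TYPED (2.21c) FACTOR ON ξℤ³** — *"Now we replace the propagators G^η_{j₀}(0), G^η_{j₀} by C^ξ … We get a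
convergent expression plus Σ_{y,y″}ξ^{2d}Γ″_μ(y,y′,y″) defined with the help of the propagator C^ξ. … For the graph (2.21c) it equals
0"*: for `L = ℓ + 1 ≥ 2` and a window `[a₋,a₊] × [0,m²₊]` (`a₋ > 0`) there is `Cst > 0` such that for every `k ≥ 1` (`ξ = L^{−k}`),
all three parameter pairs in the window (`G_i = G^ξ_k(0)` = `GxiL`: the differentiated line, the scalar loop line, the vector loop
line), all `μ`, `x′`:
(i) the typed factor `Σ_{x,x″}ξ^{2d}Γ^{(2.21)c}_μ[G₁,G₂,G₃](x,x′,x″)` (`B3GammaPrimeVanishing.locFactorZ (gamma221cZ …)` = `coeff336Z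
(gamma221c …)`) equals the kernel-slot factor `F[G₁,G₂,G₃](x′)` of `B3Graph221cZeroLattice`;
(ii) **`|Σ_{x,x″}ξ^{2d}Γ^{(2.21)c}_μ[G₁,G₂,G₃]| ≤ Cst`** uniformly in the spacing and the position;
(iii) with `C^ξ` in every slot the typed factor is `0` (`B3GammaPrimeVanishing.locFactorZ_gamma221cZ_cxi_eq_zero` — *"a derivative
of a constant"*), so the typed factor at `G^ξ_k(0)` IS the convergent expression of the replacement.
[cite: Balaban1983Higgs3, p.444] -/
theorem exists_locFactorZ_gamma221cZ_bound (hℓ : 1 ≤ ℓ) (amin aplus m2plus : ℝ) (ha : 0 < amin) :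
    ∃ Cst : ℝ, 0 < Cst ∧ ∀ (k : ℕ), 1 ≤ k → ∀ (a₁ m₁ a₂ m₂ a₃ m₃ : ℝ), amin ≤ a₁ → a₁ ≤ aplus → 0 ≤ m₁ → m₁ ≤ m2plus →
      amin ≤ a₂ → a₂ ≤ aplus → 0 ≤ m₂ → m₂ ≤ m2plus → amin ≤ a₃ → a₃ ≤ aplus → 0 ≤ m₃ → m₃ ≤ m2plus →
      ∀ (μ : Fin 3) (x' : ZSite 3),
      locFactorZ (d := 2) (xiOf ℓ k) (gamma221cZ (xiOf ℓ k) (GxiL ℓ k a₁ m₁) (GxiL ℓ k a₂ m₂) (GxiL ℓ k a₃ m₃)) μ x' =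
          fac221c (xiOf ℓ k) μ (GxiL ℓ k a₁ m₁) (GxiL ℓ k a₂ m₂) (GxiL ℓ k a₃ m₃) x' ∧
      coeff336Z (d := 2) (xiOf ℓ k) (gamma221c (xiOf ℓ k) (GxiL ℓ k a₁ m₁) (GxiL ℓ k a₂ m₂) (GxiL ℓ k a₃ m₃)) μ x' =
          fac221c (xiOf ℓ k) μ (GxiL ℓ k a₁ m₁) (GxiL ℓ k a₂ m₂) (GxiL ℓ k a₃ m₃) x' ∧
      |locFactorZ (d := 2) (xiOf ℓ k) (gamma221cZ (xiOf ℓ k) (GxiL ℓ k a₁ m₁) (GxiL ℓ k a₂ m₂) (GxiL ℓ k a₃ m₃)) μ x'|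
        ≤ Cst ∧
      locFactorZ (d := 2) (xiOf ℓ k) (gamma221cZ (xiOf ℓ k) (convKZ (Cxi (2 + 1) (xiOf ℓ k)))
          (convKZ (Cxi (2 + 1) (xiOf ℓ k))) (convKZ (Cxi (2 + 1) (xiOf ℓ k)))) μ x' = 0 := by
  obtain ⟨Cst, hCst, H⟩ := exists_fac221c_bound hℓ amin aplus m2plus ha
  obtain ⟨δ, C, K, hδ, hδh, hC1, -, HL⟩ := exists_bounds hℓ amin aplus m2plus ha
  have hδ1 : δ ≤ 1 := hδh.trans (by norm_num)
  have hC0 : 0 ≤ C := le_trans (by norm_num) hC1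
  refine ⟨Cst, hCst, ?_⟩
  intro k hk a₁ m₁ a₂ m₂ a₃ m₃ ha1 ha1' hm1 hm1' ha2 ha2' hm2 hm2' ha3 ha3' hm3 hm3' μ x'
  obtain ⟨hloop, -, -, -, hbound⟩ := H k hk a₁ m₁ a₂ m₂ a₃ m₃ ha1 ha1' hm1 hm1' ha2 ha2' hm2 hm2' ha3 ha3' hm3 hm3' μ x'
  obtain ⟨⟨-, -, -, g1d2, -, -, -, -, -⟩, -⟩ := HL k hk a₁ m₁ ha1 ha1' hm1 hm1'
  obtain ⟨⟨-, -, g2d, -, -, -, -, -, -⟩, -⟩ := HL k hk a₂ m₂ ha2 ha2' hm2 hm2'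
  obtain ⟨⟨g3, -, -, -, -, -, -, -, -⟩, -⟩ := HL k hk a₃ m₃ ha3 ha3' hm3 hm3'
  have hξ : 0 < xiOf ℓ k := xiOf_pos ℓ k
  have hξ1 : xiOf ℓ k ≤ 1 := xiOf_le_one ℓ k
  have hF := summable_uncurry_of_laws hξ hξ1 hδ hδ1 hC0 g1d2 g2d g3 μ x'
  have heq := locFactorZ_gamma221cZ_eq_fac221c hξ.ne' (GxiL ℓ k a₁ m₁) (GxiL ℓ k a₂ m₂) (GxiL ℓ k a₃ m₃) μ x' hF hloop
  refine ⟨heq, ?_, ?_, ?_⟩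
  · rw [coeff336Z_gamma221c_eq_locFactorZ hξ.ne']; exact heq
  · rw [heq]; exact hbound
  · exact locFactorZ_gamma221cZ_cxi_eq_zero (d := 2) hξ μ x'

end Main

end

end Literature.MathematicalPhysics.QuantumFieldTheory.Balaban1983to89.B3Graph221cZeroLatticeBridge
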